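import Literature.Geometry.Lorentzian.ApproximateKerrConfiguration
import Summits.FinalStateConjecture.FinalStateConjecture.Theorems.RenormalisedDriftDriftCapturePinnedOfSettle
import HarnessLib

/-!
# FREEZE bookkeeping for crux `DriftCapture` (stmt-FinalStateConjecture-17391), line `registered` v10:
# Cauchy labels along ONE family of configurations pin THAT family at a point of the moduli space

The landed `stub_pinnedOfCauchyChain` (p157120, `Theorems/RenormalisedDriftDriftCapturePinnedOfCauchyChain.lean`)
re-packages the sharpening chain existentially: from a chain with Cauchy labels it returns SOME chain (in the proof: the
same one) eventually pinned at a limit label `(M, a, Λ)`. When the seam between the engine and the gluing carries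
further clauses about the chain (v10 of the skeleton `Cruxes/DriftCapture/Lines/birth.lean`: fat chaining, forward hole
charts, forward flat charts), an existential re-packaging loses them. This file proves the label statement for THE GIVEN
family, with no chain clause at all in the hypotheses: for any family `n ↦ cₙ` of approximate `N`-Kerr configurations of
one region (any `k`, `τ`, `L`; accuracies `εₙ` and radii `Rₙ` arbitrary) with exactly `N` holes, labels in the box
`Mᵢ ∈ [m₀, m₀⁻¹]`, `|aᵢ| ≤ χ Mᵢ`, and CAUCHY labels (masses, spins, boosts in operator norm, equal hole indices), there is
ONE label `(M, a, Λ)` in the box, `Λⱼ ∈ O(1,3)`, at which the family is eventually `δ`-pinned for every `δ > 0`.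

Proof (verbatim the argument of p157120): the label vectors are a Cauchy sequence of the complete space
`(Fin N → ℝ) × (Fin N → ℝ) × (Fin N → (E4 →L[ℝ] E4))`, hence converge; they eventually lie in the closed label set of
`isClosed_labelSet` (box × `η`-isometries of norm `≤ ‖p‖ + 1`, p155010), so the limit is in the box and its boost
components are Lorentz transformations (`exists_lorentzGroup_coe_eq`, p155010).

No definitions, no named facts. References: Klainerman, C. R. Mécanique 353 (2025), §2.3 (asymptotic versus orbital
stability along the Kerr family); O'Neill 1983, Ch. 9, pp. 233–236 (`O(1,3)` closed).
-/

-- the doubled `FinalStateConjecture.FinalStateConjecture` path component trips dupNamespace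
set_option linter.dupNamespace false

noncomputable section

namespace Summit.FinalStateConjecture.FinalStateConjecture.Theorems.RenormalisedDrift.DriftCapture

open Set Filter Topology
open scoped Manifold ContDiff ENNReal
open Literature.Geometry.Lorentzian


/-- **Cauchy labels pin the given family of configurations at one point of the moduli space.** For a family
`n ↦ cₙ` of approximate `N`-Kerr configurations of one region `O` of a spacetime (accuracies `εₙ`, radii `Rₙ`, any
`k`, `τ`, `L`) with `(cₙ).N = N`, labels in the box `m₀ ≤ Mᵢ ≤ m₀⁻¹`, `|aᵢ| ≤ χ Mᵢ`, and Cauchy labels — for every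
`δ > 0`, from some `n₀` on, any two members' labels at equal hole indices agree within `δ` (masses, spins, boosts in
operator norm) — there are `M a : Fin N → ℝ` in the box and `Λ : Fin N → lorentzGroup` such that THE SAME family is
eventually `δ`-pinned at `(M, a, Λ)` for every `δ > 0`. Completeness of the finite-dimensional label space; the label
box and `O(1,3)` are closed (registered sub-goal `exists_pinned_of_cauchyLabels` of crux stmt-FinalStateConjecture-17391,
the same-family form of the landed `stub_pinnedOfCauchyChain`). Klainerman, C. R. Mécanique 353 (2025), §2.3. [folklore] -/
theorem exists_pinned_of_cauchyLabels : ∀ {𝓢 : Spacetime 4} {O : Set 𝓢.carrier} {k : ℕ} {ε : ℕ → ENNReal} {τ L : ℝ} {R : ℕ → ℝ} (c : ∀ n : ℕ, ApproximateKerrConfiguration 𝓢 O k (ε n) τ L (R n)) (N : ℕ) (m₀ χ : ℝ), (∀ n, (c n).N = N) → (∀ n (i : Fin (c n).N), m₀ ≤ (c n).mass i ∧ (c n).mass i ≤ m₀⁻¹ ∧ |(c n).spin i| ≤ χ * (c n).mass i) → (∀ δ : ℝ, 0 < δ → ∃ n₀ : ℕ, ∀ n n' : ℕ, n₀ ≤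 n → n₀ ≤ n' → ∀ (i : Fin (c n).N) (i' : Fin (c n').N), (i : ℕ) = (i' : ℕ) → |(c n).mass i - (c n').mass i'| ≤ δ ∧ |(c n).spin i - (c n').spin i'| ≤ δ ∧ ‖((((c n).motion i).1 : E4 ≃L[ℝ] E4) : E4 →L[ℝ] E4) - ((((c n').motion i').1 : E4 ≃L[ℝ] E4) : E4 →L[ℝ] E4)‖ ≤ δ) → ∃ (M a : Fin N → ℝ) (Λ : Fin N → lorentzGroup), (∀ j, m₀ ≤ M j ∧ M j ≤ m₀⁻¹ ∧ |a j| ≤ χ * M j) ∧ ∀ δ : ℝ, 0 < δ → ∃ n₀ : ℕ, ∀ n, n₀ ≤ n → ∀ (i : Fin (c n).N) (j : Fin N), (i : ℕ) = (j : ℕ) → |(c n).mass i - M j| ≤ δ ∧ |(c n).spin i - a j| ≤ δ ∧ ‖((((c n).motion i).1 : E4 ≃L[ℝ] E4) : E4 →L[ℝ] E4) - (((Λ j : E4 ≃L[ℝ] E4)) : E4 →L[ℝ] E4)‖ ≤ δ := by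
  intro 𝓢 O k ε τ L R c N m₀ χ hN hM hcauchy
  -- the label vectors of the members
  let q : ℕ → (Fin N → ℝ) × (Fin N → ℝ) × (Fin N → (E4 →L[ℝ] E4)) := fun n ↦
    (fun j ↦ (c n).mass (Fin.cast (hN n).symm j), fun j ↦ (c n).spin (Fin.cast (hN n).symm j),
      fun j ↦ ((((c n).motion (Fin.cast (hN n).symm j)).1 : E4 ≃L[ℝ] E4) : E4 →L[ℝ] E4))
  -- Step 1: they form a Cauchy sequence (sup norms: componentwise `≤ δ/2 < δ`)
  have hq : CauchySeq q := by
    refine Metric.cauchySeq_iff.2 fun δ hδ ↦ ?_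
    obtain ⟨n₀, hn₀⟩ := hcauchy (δ / 2) (half_pos hδ)
    refine ⟨n₀, fun n hn n' hn' ↦ ?_⟩
    rw [dist_eq_norm]
    refine lt_of_le_of_lt ?_ (half_lt_self hδ)
    have hδ2 : 0 ≤ δ / 2 := (half_pos hδ).le
    have hcomp : ∀ j : Fin N, |(c n).mass (Fin.cast (hN n).symm j) - (c n').mass (Fin.cast (hN n').symm j)| ≤ δ / 2 ∧
        |(c n).spin (Fin.cast (hN n).symm j) - (c n').spin (Fin.cast (hN n').symm j)| ≤ δ / 2 ∧
        ‖((((c n).motion (Fin.cast (hN n).symm j)).1 : E4 ≃L[ℝ] E4) : E4 →L[ℝ] E4) -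
          ((((c n').motion (Fin.cast (hN n').symm j)).1 : E4 ≃L[ℝ] E4) : E4 →L[ℝ] E4)‖ ≤ δ / 2 :=
      fun j ↦ hn₀ n n' hn hn' _ _ rfl
    rw [Prod.norm_def, Prod.norm_def]
    refine max_le ((pi_norm_le_iff_of_nonneg hδ2).2 fun j ↦ ?_)
      (max_le ((pi_norm_le_iff_of_nonneg hδ2).2 fun j ↦ ?_) ((pi_norm_le_iff_of_nonneg hδ2).2 fun j ↦ ?_))
    · rw [Prod.fst_sub, Pi.sub_apply, Real.norm_eq_abs]; exact (hcomp j).1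
    · rw [Prod.snd_sub, Prod.fst_sub, Pi.sub_apply, Real.norm_eq_abs]; exact (hcomp j).2.1
    · rw [Prod.snd_sub, Prod.snd_sub, Pi.sub_apply]; exact (hcomp j).2.2
  -- Step 2: the limit, and the closed label set it lies in
  obtain ⟨p, hp⟩ := cauchySeq_tendsto_of_complete hq
  set C : ℝ := ‖p‖ + 1 with hC
  have hmem : p ∈ {x : (Fin N → ℝ) × (Fin N → ℝ) × (Fin N → (E4 →L[ℝ] E4)) |
      (∀ j, m₀ ≤ x.1 j ∧ x.1 j ≤ m₀⁻¹ ∧ |x.2.1 j| ≤ χ * x.1 j) ∧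
      ∀ j, (∀ v w, Minkowski.bilin (x.2.2 j v) (x.2.2 j w) = Minkowski.bilin v w) ∧ ‖x.2.2 j‖ ≤ C} := by
    refine (isClosed_labelSet N m₀ χ C).mem_of_tendsto hp ?_
    have hev : ∀ᶠ n in atTop, dist (q n) p < 1 := Metric.tendsto_atTop.1 hp 1 one_pos |>.elim
      fun n₁ hn₁ ↦ eventually_atTop.2 ⟨n₁, hn₁⟩
    filter_upwards [hev] with n hn
    refine ⟨fun j ↦ hM n _, fun j ↦ ⟨fun v w ↦ ((c n).motion (Fin.cast (hN n).symm j)).1.2 v w, ?_⟩⟩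
    calc ‖(q n).2.2 j‖ ≤ ‖(q n).2.2‖ := norm_le_pi_norm _ j
      _ ≤ ‖q n‖ := (norm_snd_le (q n).2).trans (norm_snd_le (q n))
      _ ≤ C := norm_le_of_mem_closedBall (Metric.mem_closedBall.2 hn.le)
  obtain ⟨hbox, hlor⟩ := hmem
  choose Λ hΛ using fun j ↦ exists_lorentzGroup_coe_eq (p.2.2 j) (hlor j).1
  refine ⟨p.1, p.2.1, Λ, hbox, fun δ hδ ↦ ?_⟩
  -- Step 3: eventual pinning at the limit
  obtain ⟨n₀, hn₀⟩ := Metric.tendsto_atTop.1 hp δ hδ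
  refine ⟨n₀, fun n hn i j hij ↦ ?_⟩
  have hdist : ‖q n - p‖ ≤ δ := by rw [← dist_eq_norm]; exact (hn₀ n hn).le
  have hi : i = Fin.cast (hN n).symm j := Fin.ext hij
  subst hi
  refine ⟨?_, ?_, ?_⟩
  · have := (norm_le_pi_norm ((q n).1 - p.1) j).trans ((norm_fst_le (q n - p)).trans hdist)
    rwa [Pi.sub_apply, Real.norm_eq_abs] at this
  · have := (norm_le_pi_norm ((q n).2.1 - p.2.1) j).trans
      ((norm_fst_le (q n - p).2).trans ((norm_snd_le (q n - p)).trans hdist))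
    rwa [Pi.sub_apply, Real.norm_eq_abs] at this
  · have := (norm_le_pi_norm ((q n).2.2 - p.2.2) j).trans
      ((norm_snd_le (q n - p).2).trans ((norm_snd_le (q n - p)).trans hdist))
    rwa [Pi.sub_apply, ← hΛ j] at this

end Summit.FinalStateConjecture.FinalStateConjecture.Theorems.RenormalisedDrift.DriftCapture

end
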